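import Summits.BirchSwinnertonDyer.BirchSwinnertonDyer.Theorems.Rank2ObservatoryCertificate
import Summits.BirchSwinnertonDyer.BirchSwinnertonDyer.Theorems.Rank2ObservatoryRank3Exactness
import Literature.NumberTheory.EllipticCurves.BSDRootNumberOddParityProofs
import HarnessLib

/-!
# BirchSwinnertonDyer — rank ≥ 2 observatory: the rank-3 census table, row schema and soundness

HONEST FRAMING: per-curve certified theorems and census instruments; no claim on BSD in rank ≥ 2.

The observatory certifies, for every one of the `9 487` curves of rank `3` and conductor `< 500 000`
in Cremona's table (`8 899` isogeny classes), the weak-BSD equality `r_an(E) = rank_ℤ E(ℚ)` from a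
two-engine certificate (`FACTORY.md § RANK-3 CERTIFICATE`; engine P = PARI/GP + Arb, engine B =
integer-interval arithmetic in the Python standard library). The per-curve files
`Rank2Observatory<Label>.lean` (e.g. `5077a1`) spell one certificate out by hand. THIS file is the
SCHEMA of the machine-written census table `Rank2ObservatoryRank3Rows*.lean` /
`Rank2ObservatoryRank3Census.lean`: a row (`Rank3Row`) records the reduced minimal model
`[a₁,a₂,a₃,a₄,a₆]`, the conductor `N`, the certificate's Heegner discriminant `D` with a square root
`s` of `D` modulo the odd part of `N`, and the three listed generators as projective integer triples;
`Rank3Row.check` is the Boolean row predicate the kernel evaluates on every row (`decide`, no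
`native_decide`, no extra axioms):

* `Δ ≠ 0` (integer discriminant, Mathlib's formula) — so the row's curve `IsElliptic`;
* each generator `[X:Y:Z]`, `Z ≠ 0`, satisfies the homogenised Weierstrass equation over `ℤ` — so
  `(X/Z, Y/Z)` is a nonsingular point of `E(ℚ)` (`Rank3Row.gen₁…₃`);
* the KRONECKER CONDITION of the Heegner hypothesis for `(N, D)` WITHOUT factoring `N`:
  `s² ≡ D (mod M)` and `gcd(D, M) = 1` for the odd part `M` of `N`, and `D ≡ 1 (mod 8)` if `N` is
  even — so every odd prime `p ∣ N` has `(D/p) = +1` (`Rank3Row.kronecker_of_check`), which is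
  exactly the hypothesis `hkr` of the tree theorem `deriv_entireLFunction_one_eq_zero_of_kronecker`;
* data integrity: `0 < N`, `D < −4`, and `D` has the shape of a fundamental discriminant
  (`D ≡ 1 (mod 4)` squarefree, or `D = 4m`, `m ≡ 2, 3 (mod 4)` squarefree; trial division) — so the
  hypothesis "`K` imaginary quadratic of discriminant `D`" of the row theorem is satisfiable.

Given `check = true`, the two ROW THEOREMS are the per-curve theorems of `Rank2Observatory5077a1.lean`
for an arbitrary row, with the certificate fields as NAMED HYPOTHESES (never axioms):
`Rank3Row.rank3_lderiv_eq_zero` (`L'(E,1) = 0` EXACTLY, REFEREE R1/R1.L shape: Gross–Zagier–Kolyvagin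
over `K = ℚ(√D)` in contrapositive, inputs `hE` modularity, `hGZKK` the tree's GZK-over-`K` fact,
`hmin`/`hN` minimal model of conductor `N`, `hK`/`hdK`, `hlow : 3 ≤ rank`, `hw : w = −1`,
`hLD : L(E^D,1) ≠ 0`; the Heegner hypothesis is DISCHARGED from the row) and
`Rank3Row.analyticRank_eq_rank` (`r_an = rank` from `hGZK`, `hlow`, `hup`, `hL3 : L'''(E,1) ≠ 0`, `hw`,
via `analyticRank_eq_mordellWeilRank_of_rank3Certificate`). What stays a hypothesis and why is the
list of `Rank2ObservatoryCertificate.lean`; nothing here is specific to rank `3` except the names.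

References: B. H. Gross, LMS LNS 153 (1991), (1.1) and Thm. 1.3 (Gross–Zagier–Kolyvagin over `K`;
Heegner hypothesis); H. Darmon, CBMS 101 (2004), Hypothesis 3.9 (Kronecker form); J. E. Cremona,
*Algorithms for Modular Elliptic Curves* (2nd ed. 1997), §2.13 and §3.1 (models, discriminant);
J. H. Silverman, AEC III.1 (the quantities `b₂, b₄, b₆, b₈, Δ`).
-/

-- single-conjunct summit: `Summit.BirchSwinnertonDyer.BirchSwinnertonDyer.…` repeats the name by design
set_option linter.dupNamespace false

namespace Summit.BirchSwinnertonDyer.BirchSwinnertonDyer.Rank2Observatory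

open Literature Literature.NumberTheory.EllipticCurves WeierstrassCurve

/-! ### Computable helpers (kernel-evaluated) -/

/-- `oddPartAux fuel n`: divide `n` by `2` while it is even, at most `fuel` times. [folklore] -/
def oddPartAux : ℕ → ℕ → ℕ
  | 0, n => n
  | fuel + 1, n => if n % 2 = 1 then n else oddPartAux fuel (n / 2)

/-- The odd part of `n < 2⁶⁰` (for `n = 0` the value is `0`). [folklore] -/
def oddPart (n : ℕ) : ℕ := oddPartAux 60 n

/-- An odd prime dividing `n` divides `oddPartAux fuel n`. [folklore] -/
theorem dvd_oddPartAux {p : ℕ} (hp : p.Prime) (hp2 : p ≠ 2) :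
    ∀ (fuel n : ℕ), p ∣ n → p ∣ oddPartAux fuel n := by
  intro fuel
  induction fuel with
  | zero => intro n h; simpa [oddPartAux] using h
  | succ k ih =>
    intro n h
    simp only [oddPartAux]
    split
    · exact h
    · apply ih
      have h2 : n = 2 * (n / 2) := by omega
      rw [h2] at h
      rcases (Nat.Prime.dvd_mul hp).mp h with h' | h'
      · exact absurd ((Nat.prime_dvd_prime_iff_eq hp Nat.prime_two).mp h') hp2
      · exact h'

/-- An odd prime dividing `n` divides `oddPart n`. [folklore] -/
theorem dvd_oddPart {p n : ℕ} (hp : p.Prime) (hp2 : p ≠ 2) (h : p ∣ n) : p ∣ oddPart n :=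
  dvd_oddPartAux hp hp2 60 n h

/-- `squarefreeAux n fuel k`: no `j` with `k ≤ j`, `j² ≤ n` has `j² ∣ n` (trial division, `fuel`
steps; `false` if the fuel runs out). A data-integrity check only. [folklore] -/
def squarefreeAux (n : ℕ) : ℕ → ℕ → Bool
  | 0, _ => false
  | fuel + 1, k => if n < k * k then true else if n % (k * k) = 0 then false
      else squarefreeAux n fuel (k + 1)

/-- Trial-division squarefreeness of a positive natural number (data-integrity check). [folklore] -/
def squarefreeB (n : ℕ) : Bool := decide (0 < n) && squarefreeAux n n 2

/-- `D` has the shape of a fundamental discriminant: `D ≡ 1 (mod 4)` squarefree, or `D = 4m` with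
`m ≡ 2, 3 (mod 4)` squarefree (Cremona 1997 §3.1; data-integrity check, by trial division).
[folklore] -/
def isFundDiscB (D : ℤ) : Bool :=
  (decide (D % 4 = 1) && squarefreeB D.natAbs) ||
    (decide (D % 16 = 8 ∨ D % 16 = 12) && squarefreeB (D.natAbs / 4))

/-! ### The row schema -/

/-- One row of the rank-3 census table: Cremona label, reduced minimal model `[a₁,a₂,a₃,a₄,a₆]`,
conductor `N`, the certificate's Heegner discriminant `D` (`heegner_D`, the cross-engine choice:
smallest `|D|` with the Heegner hypothesis and a certified `L(E^D,1) ≠ 0`), a square root `s` of `D`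
modulo the odd part of `N` (a witness computed by the table generator; any value works if it checks),
and the three listed generators of `E(ℚ)/tors` as projective integer triples `[X:Y:Z]` (Cremona's
`allgens`). [folklore] -/
structure Rank3Row where
  /-- Cremona label `N<class><number>`. -/
  label : String
  /-- `a₁` -/
  a₁ : ℤ
  /-- `a₂` -/
  a₂ : ℤ
  /-- `a₃` -/
  a₃ : ℤ
  /-- `a₄` -/
  a₄ : ℤ
  /-- `a₆` -/
  a₆ : ℤ
  /-- the conductor `N_E` (certificate field `conductor`, both engines; Cremona's table) -/
  N : ℕ
  /-- the certificate's Heegner discriminant `D = d_K` -/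
  D : ℤ
  /-- a square root of `D` modulo the odd part of `N` -/
  s : ℤ
  /-- first listed generator `[X:Y:Z]` -/
  P₁ : ℤ × ℤ × ℤ
  /-- second listed generator `[X:Y:Z]` -/
  P₂ : ℤ × ℤ × ℤ
  /-- third listed generator `[X:Y:Z]` -/
  P₃ : ℤ × ℤ × ℤ

namespace Rank3Row

variable (r : Rank3Row)

/-- The row's Weierstrass model over `ℚ`. [folklore] -/
def curve : WeierstrassCurve ℚ := ⟨r.a₁, r.a₂, r.a₃, r.a₄, r.a₆⟩

/-- The row's integer discriminant `Δ = −b₂²b₈ − 8b₄³ − 27b₆² + 9b₂b₄b₆` (Silverman AEC III.1;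
Mathlib's `WeierstrassCurve.Δ`, spelled out over `ℤ` for kernel evaluation). [folklore] -/
def delta : ℤ :=
  let b₂ := r.a₁ * r.a₁ + 4 * r.a₂
  let b₄ := 2 * r.a₄ + r.a₁ * r.a₃
  let b₆ := r.a₃ * r.a₃ + 4 * r.a₆
  let b₈ := r.a₁ * r.a₁ * r.a₆ + 4 * r.a₂ * r.a₆ - r.a₁ * r.a₃ * r.a₄ + r.a₂ * (r.a₃ * r.a₃) -
    r.a₄ * r.a₄
  9 * (b₂ * b₄ * b₆) - b₂ * b₂ * b₈ - 8 * (b₄ * b₄ * b₄) - 27 * (b₆ * b₆)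

/-- `[X:Y:Z]` with `Z ≠ 0` lies on the row's curve: the homogenised Weierstrass equation over `ℤ`,
`Y²Z + a₁XYZ + a₃YZ² = X³ + a₂X²Z + a₄XZ² + a₆Z³` (a Boolean, kernel-evaluated). [folklore] -/
def onCurve (P : ℤ × ℤ × ℤ) : Bool :=
  decide (P.2.2 ≠ 0 ∧
    P.2.1 * P.2.1 * P.2.2 + r.a₁ * P.1 * P.2.1 * P.2.2 + r.a₃ * P.2.1 * P.2.2 * P.2.2 =
      P.1 * P.1 * P.1 + r.a₂ * P.1 * P.1 * P.2.2 + r.a₄ * P.1 * P.2.2 * P.2.2 +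
        r.a₆ * P.2.2 * P.2.2 * P.2.2)

/-- The row predicate evaluated by the kernel on every row of the census table (see the module
docstring): `Δ ≠ 0`; the three generators on the curve; `0 < N`; the Kronecker condition for
`(N, D)` via the square-root witness `s` modulo the odd part of `N`, coprimality, and `D ≡ 1 (mod 8)`
for even `N`; `D < −4` of fundamental-discriminant shape. A Boolean (`decide` of a decidable
conjunction), so that a table theorem reads `rows.all Rank3Row.check = true`. [folklore] -/
def check : Bool :=
  decide (r.delta ≠ 0 ∧ r.onCurve r.P₁ = true ∧ r.onCurve r.P₂ = true ∧ r.onCurve r.P₃ = true ∧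
    0 < r.N ∧ (r.N % 2 = 1 ∨ r.D % 8 = 1) ∧ (r.s * r.s - r.D) % (oddPart r.N : ℤ) = 0 ∧
    Int.gcd r.D (oddPart r.N) = 1 ∧ r.D < -4 ∧ isFundDiscB r.D = true)

/-- What a checking row satisfies, as a conjunction of propositions. [folklore] -/
theorem check_spec (h : r.check = true) :
    r.delta ≠ 0 ∧ r.onCurve r.P₁ = true ∧ r.onCurve r.P₂ = true ∧ r.onCurve r.P₃ = true ∧
    0 < r.N ∧ (r.N % 2 = 1 ∨ r.D % 8 = 1) ∧ (r.s * r.s - r.D) % (oddPart r.N : ℤ) = 0 ∧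
    Int.gcd r.D (oddPart r.N) = 1 ∧ r.D < -4 ∧ isFundDiscB r.D = true :=
  of_decide_eq_true h

/-! ### Soundness of the row predicate -/

/-- The model's discriminant is the row's integer `Δ`. [folklore] -/
theorem curve_Δ : r.curve.Δ = (r.delta : ℚ) := by
  simp only [curve, delta, WeierstrassCurve.Δ, WeierstrassCurve.b₂, WeierstrassCurve.b₄,
    WeierstrassCurve.b₆, WeierstrassCurve.b₈]
  push_cast
  ring

/-- A checking row's curve has `Δ ≠ 0`. [folklore] -/
theorem Δ_ne_zero (h : r.check = true) : r.curve.Δ ≠ 0 := by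
  rw [curve_Δ]
  exact_mod_cast (r.check_spec h).1

/-- A row with `delta ≠ 0` defines an elliptic curve (used with `(r.check_spec h).1`). [folklore] -/
theorem isElliptic_of_delta_ne_zero (hd : r.delta ≠ 0) : r.curve.IsElliptic :=
  ⟨isUnit_iff_ne_zero.mpr (by rw [curve_Δ]; exact_mod_cast hd)⟩

/-- A projective integer triple `[X:Y:Z]`, `Z ≠ 0`, on the homogenised equation gives the affine
point `(X/Z, Y/Z)` of the curve over `ℚ`. [folklore] -/
theorem equation_of_onCurve {P : ℤ × ℤ × ℤ} (h : r.onCurve P = true) :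
    r.curve.toAffine.Equation ((P.1 : ℚ) / P.2.2) ((P.2.1 : ℚ) / P.2.2) := by
  obtain ⟨hZ, hE⟩ := of_decide_eq_true h
  have hZ' : (P.2.2 : ℚ) ≠ 0 := by exact_mod_cast hZ
  rw [WeierstrassCurve.Affine.equation_iff]
  have hl : ((P.2.1 : ℚ) / P.2.2) ^ 2 + r.curve.a₁ * (P.1 / P.2.2) * (P.2.1 / P.2.2) +
      r.curve.a₃ * (P.2.1 / P.2.2) =
      ((P.2.1 : ℚ) * P.2.1 * P.2.2 + r.a₁ * P.1 * P.2.1 * P.2.2 + r.a₃ * P.2.1 * P.2.2 * P.2.2) /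
        (P.2.2 : ℚ) ^ 3 := by
    simp only [curve]; field_simp
  have hr : ((P.1 : ℚ) / P.2.2) ^ 3 + r.curve.a₂ * (P.1 / P.2.2) ^ 2 + r.curve.a₄ * (P.1 / P.2.2) +
      r.curve.a₆ =
      ((P.1 : ℚ) * P.1 * P.1 + r.a₂ * P.1 * P.1 * P.2.2 + r.a₄ * P.1 * P.2.2 * P.2.2 +
        r.a₆ * P.2.2 * P.2.2 * P.2.2) / (P.2.2 : ℚ) ^ 3 := by
    simp only [curve]; field_simp
  rw [hl, hr]
  exact congrArg (fun z : ℚ => z / (P.2.2 : ℚ) ^ 3) (by exact_mod_cast hE)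

/-- … and that point is nonsingular (`Δ ≠ 0`). [folklore] -/
theorem nonsingular_of_onCurve (h : r.check = true) {P : ℤ × ℤ × ℤ} (hP : r.onCurve P = true) :
    r.curve.toAffine.Nonsingular ((P.1 : ℚ) / P.2.2) ((P.2.1 : ℚ) / P.2.2) :=
  (WeierstrassCurve.Affine.equation_iff_nonsingular_of_Δ_ne_zero (r.Δ_ne_zero h)).mp
    (r.equation_of_onCurve hP)

/-- The first listed generator as a point of `E(ℚ)`. [folklore] -/
def gen₁ (h : r.check = true) : r.curve.toAffine.Point :=
  .some (h := r.nonsingular_of_onCurve h (r.check_spec h).2.1)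

/-- The second listed generator as a point of `E(ℚ)`. [folklore] -/
def gen₂ (h : r.check = true) : r.curve.toAffine.Point :=
  .some (h := r.nonsingular_of_onCurve h (r.check_spec h).2.2.1)

/-- The third listed generator as a point of `E(ℚ)`. [folklore] -/
def gen₃ (h : r.check = true) : r.curve.toAffine.Point :=
  .some (h := r.nonsingular_of_onCurve h (r.check_spec h).2.2.2.1)

/-- **Kronecker condition from the row** (Darmon 2004, Hypothesis 3.9; Gross 1991 (1.1)): for a
checking row every prime `p ∣ N` satisfies `p = 2 → D ≡ 1 (mod 8)` and `p ≠ 2 → (D/p) = +1` — an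
odd `p ∣ N` divides the odd part `M`, `s² ≡ D (mod p)` and `p ∤ D` (as `gcd(D, M) = 1`), so the
Legendre symbol is `+1`. No factorisation of `N` is needed. [cite: Darmon2004, Hypothesis 3.9] -/
theorem kronecker_of_check (h : r.check = true) :
    ∀ p : ℕ, p.Prime → p ∣ r.N → (p = 2 → r.D % 8 = 1) ∧ (p ≠ 2 → jacobiSym r.D p = 1) := by
  obtain ⟨-, -, -, -, -, hpar, hsq, hgcd, -, -⟩ := r.check_spec h
  intro p hp hpN
  refine ⟨fun h2 ↦ ?_, fun hp2 ↦ ?_⟩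
  · subst h2
    rcases hpar with h' | h'
    · omega
    · exact h'
  · haveI : Fact p.Prime := ⟨hp⟩
    have hpM : p ∣ oddPart r.N := dvd_oddPart hp hp2 hpN
    have hpM' : (p : ℤ) ∣ (oddPart r.N : ℤ) := Int.natCast_dvd_natCast.mpr hpM
    have hsq' : (p : ℤ) ∣ r.s * r.s - r.D := dvd_trans hpM' (Int.dvd_of_emod_eq_zero hsq)
    have hDs : (r.D : ZMod p) = ((r.s * r.s : ℤ) : ZMod p) :=
      (ZMod.intCast_eq_intCast_iff_dvd_sub r.D (r.s * r.s) p).mpr hsq'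
    have hD0 : (r.D : ZMod p) ≠ 0 := by
      intro h0
      have hpD : (p : ℤ) ∣ r.D := (ZMod.intCast_zmod_eq_zero_iff_dvd r.D p).mp h0
      have h1 : p ∣ Int.gcd r.D (oddPart r.N) := Int.dvd_gcd hpD hpM'
      rw [hgcd] at h1
      exact hp.one_lt.ne' (Nat.dvd_one.mp h1)
    rw [← jacobiSym.legendreSym.to_jacobiSym, legendreSym.eq_one_iff p hD0]
    exact ⟨(r.s : ZMod p), by rw [hDs]; push_cast; ring⟩

/-! ### The row theorems (certificate fields as named hypotheses) -/

/-- **`L(E,1) = 0` exactly** for a checking row, from the root number `−1` (certificate field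
`root_number`; the tree's proved `entireLFunction_one_eq_zero_of_rootNumber_eq_neg_one`).
[cite: CremonaAlgorithms1997, §2.13] -/
theorem entireLFunction_one_eq_zero (h : r.check = true) (hw : r.curve.rootNumber = -1) :
    r.curve.entireLFunction 1 = 0 := by
  haveI := r.isElliptic_of_delta_ne_zero (r.check_spec h).1
  exact entireLFunction_one_eq_zero_of_rootNumber_eq_neg_one hw

/-- **`rank3_lderiv_eq_zero` for a table row** (REFEREE R1 / R1.L shape) — **`L'(E,1) = 0`
EXACTLY**: Gross–Zagier–Kolyvagin over the Heegner field `K = ℚ(√D)` in contrapositive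
(`deriv_entireLFunction_one_eq_zero_of_kronecker`). Inputs by name: modularity `hE`, the tree's fact
`hGZKK`, the minimal model of conductor `N` (`hmin`, `hN`; certificate fields `conductor`,
`model.globally_minimal`, both engines), `K` imaginary quadratic of discriminant `D` (`hK`, `hdK`),
the certified rank `hlow` (`rank_lower`), the root number `hw` (for `L(E,1) = 0`) and the twist value
`hLD : L(E^D,1) ≠ 0` (`heegner.chosen` / `referee_R1.twist_L1_ball`, two engines). The Heegner
hypothesis for `(N, D)` is DISCHARGED from the row (`kronecker_of_check`).
[cite: GrossLMS1991, (1.1) and Thm. 1.3] [cite: Darmon2004, Hypothesis 3.9] -/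
theorem rank3_lderiv_eq_zero (h : r.check = true) (K : Type) [Field K] [NumberField K]
    (hE : WeierstrassCurve.hasEntireLFunction_rat)
    (hGZKK : mordellWeilRank_eq_one_of_LDerivEK_ne_zero r.curve K)
    (hmin : r.curve.IsGloballyMinimal) (hN : r.curve.conductorNorm ℤ = r.N)
    (hK : IsImaginaryQuadratic K) (hdK : NumberField.discr K = r.D)
    (hlow : 3 ≤ r.curve.mordellWeilRank) (hw : r.curve.rootNumber = -1)
    (hLD : (r.curve.quadraticTwist (r.D : ℚ)).entireLFunction 1 ≠ 0) :
    deriv r.curve.entireLFunction 1 = 0 := by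
  haveI := r.isElliptic_of_delta_ne_zero (r.check_spec h).1
  haveI := hmin
  have hd : (NumberField.discr K : ℚ) = (r.D : ℚ) := by rw [hdK]
  refine deriv_entireLFunction_one_eq_zero_of_kronecker r.curve K (N := r.N)
    (Nat.pos_iff_ne_zero.mp (r.check_spec h).2.2.2.2.1) hN hE hGZKK hK ?_ (by omega)
    (r.entireLFunction_one_eq_zero h hw) (by rw [hd]; exact hLD)
  intro p hp hpN
  rw [hdK]
  exact r.kronecker_of_check h p hp hpN

/-- **`rank_ℤ E(ℚ) = 3`** for a row from the certificate's two rank fields. [folklore] -/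
theorem mordellWeilRank_eq_three (hlow : 3 ≤ r.curve.mordellWeilRank)
    (hup : r.curve.mordellWeilRank ≤ 3) : r.curve.mordellWeilRank = 3 :=
  le_antisymm hup hlow

/-- **`analyticRank_eq_rank` for a table row** — `r_an(E) = rank_ℤ E(ℚ)` from
Gross–Zagier–Kolyvagin (`hGZK`, bsd.S17) and the four certificate fields `rank_lower` (`hlow`),
`rank_upper` (`hup`), `L3` (`hL3 : L'''(E,1) ≠ 0`, two certified balls) and `root_number`
(`hw : w = −1`), via `analyticRank_eq_mordellWeilRank_of_rank3Certificate`; ellipticity comes from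
the row. [cite: CremonaAlgorithms1997, §2.13] [cite: Darmon2004, Thm. 3.22] -/
theorem analyticRank_eq_rank (h : r.check = true)
    (hGZK : rank_eq_analyticRank_of_analyticRank_le_one)
    (hlow : 3 ≤ r.curve.mordellWeilRank) (hup : r.curve.mordellWeilRank ≤ 3)
    (hL3 : iteratedDeriv 3 r.curve.entireLFunction 1 ≠ 0) (hw : r.curve.rootNumber = -1) :
    r.curve.analyticRank = r.curve.mordellWeilRank := by
  haveI := r.isElliptic_of_delta_ne_zero (r.check_spec h).1
  exact analyticRank_eq_mordellWeilRank_of_rank3Certificate r.curve hGZK hlow hup hL3 hw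

/-- **`r_an(E) = 3`** for a row, under the same hypotheses. [cite: CremonaAlgorithms1997, §2.13] -/
theorem analyticRank_eq_three (h : r.check = true)
    (hGZK : rank_eq_analyticRank_of_analyticRank_le_one)
    (hlow : 3 ≤ r.curve.mordellWeilRank) (hup : r.curve.mordellWeilRank ≤ 3)
    (hL3 : iteratedDeriv 3 r.curve.entireLFunction 1 ≠ 0) (hw : r.curve.rootNumber = -1) :
    r.curve.analyticRank = 3 := by
  rw [r.analyticRank_eq_rank h hGZK hlow hup hL3 hw, r.mordellWeilRank_eq_three hlow hup]

/-- Rows of a table all of whose rows check, check (used by the census file with the chunk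
theorems `…_check : rows.all Rank3Row.check = true`, proved by `decide`). [folklore] -/
theorem check_of_all_check {rows : List Rank3Row} (h : rows.all Rank3Row.check = true)
    {r : Rank3Row} (hr : r ∈ rows) : r.check = true :=
  List.all_eq_true.mp h r hr

end Rank3Row

/-! ### Sanity rows (the table's first two curves; kernel) -/

/-- The rows of `5077a1` (`D = −7`) and `11197a1` (`D = −7`) check (kernel `decide`). [folklore] -/
theorem sampleRows_check :
    [(⟨"5077a1", 0, 0, 1, -7, 6, 5077, -7, 285, (1, 0, 1), (2, 0, 1), (0, 2, 1)⟩ : Rank3Row),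
      ⟨"11197a1", 1, -1, 1, -6, 0, 11197, -7, 4419, (0, 0, 1), (-1, 2, 1), (-2, 1, 1)⟩].all
      Rank3Row.check = true := by
  decide +kernel

end Summit.BirchSwinnertonDyer.BirchSwinnertonDyer.Rank2Observatory
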